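import Summits.Ventures.HodgeRepro2.T5SU11SphericalTransformDecayPole
import Summits.Ventures.HodgeRepro2.T5SU11SphericalDecayMass
import Summits.Ventures.HodgeRepro2.T5SU11KernelMass
import Summits.Ventures.HodgeRepro2.T5SU11KernelRowMonotone
import Summits.Ventures.HodgeRepro2.T5SU11KernelSupBound
import Summits.Ventures.HodgeRepro2.T5SU11SphericalDecayConvex

/-!
# Summary XXXI — the transform near its pole, the masses, the flux at the origin, and the monotonicity / convexity of the
decaying solution and of the kernel's rows (rows 632–639), under uniform names

Throughout `μ = λ(λ − 2)`, `K_λ` the kernel of `G^I_λ`, `χ_λ` the decaying solution, `Ξ = φ_1`.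

* `ground_mass_blowup`, `decay_transform_residue` — **`∫ χ_λ Ξ sinh 2s ds → +∞` as `λ → 1⁺`; `(λ − λ′) ∫ χ_λ φ_{λ′} sinh 2s ds → 1/(2(λ − 1))`
  as `λ′ → λ⁻`** (row 632);
* `decay_mass`, `kernel_comp_mass`, `neumann_transform_radius` — **`∫ χ_λ sinh 2s ds = 1/μ`, `∫ K_λ^{∘(k+1)}(t, s) sinh 2s ds = (−1/μ)^{k+1}`
  (`λ > 2`); the transformed Neumann series converges iff `|c| < |μ′ − μ|`** (rows 634–635);
* `decay_flux_origin`, `decay_flux_identity`, `decay_deriv_neg`, `decay_strictAnti` — **`sinh 2t χ_λ′ → −1` at the origin;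
  `sinh 2t χ_λ′(t) = −1 + μ ∫_0^t χ_λ sinh 2s ds`; `χ_λ′ < 0`; `χ_λ` strictly decreasing** (rows 633, 636);
* `kernel_row_strictMono_Ici`, `kernel_row_strictMono_of_lt_two`, `kernel_le_diagonal_min`, `kernel_le_decay_max` — **the rows of
  the kernel are monotone; `|K_λ(t, s)| ≤ φ_λ(a_r) χ_λ(r)` at `r = min(t, s)`; `|K_λ(t, s)| ≤ χ_λ(max(t, s))` for `λ ≤ 2`** (rows 637–638);
* `decay_strictConvex`, `kernel_row_strictConcave_Ici` — **`χ_λ` strictly convex for `λ ≥ 2`; the rows concave beyond the diagonal** (row 639).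

Nothing is claimed about (N).

Blind lane: Mathlib + the HodgeRepro2 prefix only; no sorry; axioms ⊆ {propext, Classical.choice,
Quot.sound}.
-/

namespace Summit.Ventures.HodgeRepro2.T5SU11RadialSummaryXXXI

open Filter Topology MeasureTheory
open Set (Ioi Ioc Ici)
open T5SU11Cartan T5SU11SphericalFunction T5SU11SphericalDecay T5SU11RadialGreenKernel T5SU11RadialGreenImproper
  T5SU11SphericalTransformDecayPole T5SU11SphericalDecayMass T5SU11KernelMass T5SU11SphericalDecayOriginFlux
  T5SU11SphericalDecayFluxIdentity T5SU11KernelRowMonotone T5SU11KernelSupBound T5SU11SphericalDecayConvex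

section measure

variable [MeasurableSpace Circle] [BorelSpace Circle]

/-- **The `Ξ`-mass of `χ_λ` blows up at the spectral edge** (row 632). -/
theorem ground_mass_blowup :
    Tendsto (fun lam => ∫ s in Ioi 0, sphDecay lam s * sph 1 (hyp s) * Real.sinh (2 * s)) (𝓝[>] 1) atTop :=
  tendsto_integral_sphDecay_mul_sph_one_nhdsGT_one

variable {lam : ℝ} (hlam : 1 < lam)

include hlam in
/-- **The residue of the transform of `χ_λ` at the pole `λ′ = λ`** (row 632). -/
theorem decay_transform_residue :
    Tendsto (fun lam' => (lam - lam') * ∫ s in Ioi 0, sphDecay lam s * sph lam' (hyp s) * Real.sinh (2 * s))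
      (𝓝[<] lam) (𝓝 (1 / (2 * (lam - 1)))) :=
  tendsto_sub_mul_integral_sphDecay_mul_sph hlam

/-- **`∫_0^∞ χ_λ sinh 2s ds = 1/(λ(λ − 2))`** for `λ > 2` (row 634). -/
theorem decay_mass (h2 : 2 < lam) : ∫ s in Ioi 0, sphDecay lam s * Real.sinh (2 * s) = 1 / (lam * (lam - 2)) :=
  integral_sphDecay_mul_sinh_eq h2

/-- **`∫_0^∞ K_λ^{∘(k+1)}(t, s) sinh 2s ds = (−1/μ)^{k+1}`** for `λ > 2` (row 635). -/
theorem kernel_comp_mass (h2 : 2 < lam) {t : ℝ} (ht : 0 < t) (k : ℕ) :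
    ∫ s in Ioi 0, ((greenSolI (fun t => sph lam (hyp t)) (sphDecay lam))^[k] (fun u => sphGreenKernel lam u s)) t
        * Real.sinh (2 * s)
      = (-(1 / (lam * (lam - 2)))) ^ (k + 1) :=
  integral_kernel_comp_mul_sinh_eq h2 ht k

include hlam in
/-- **The radius of the spherical transform of the Neumann series** (row 635). -/
theorem neumann_transform_radius {lam' : ℝ} (h1 : 1 < lam') (h2' : lam' < lam) {t : ℝ} (ht : 0 < t) (c : ℝ) :
    Summable (fun k : ℕ => c ^ k * ∫ s in Ioi 0,
        ((greenSolI (fun t => sph lam (hyp t)) (sphDecay lam))^[k] (fun u => sphGreenKernel lam u s)) t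
          * sph lam' (hyp s) * Real.sinh (2 * s))
      ↔ |c| < |lam' * (lam' - 2) - lam * (lam - 2)| :=
  summable_transform_kernel_comp_iff hlam h1 h2' ht c

include hlam in
/-- **The flux of the decaying solution at the origin is `−1`** (row 633). -/
theorem decay_flux_origin : Tendsto (fun t => Real.sinh (2 * t) * sphDecay' lam t) (𝓝[>] 0) (𝓝 (-1)) :=
  tendsto_sinh_mul_sphDecay'_nhdsGT_zero hlam

include hlam in
/-- **The integrated radial equation from the origin** (row 636). -/
theorem decay_flux_identity {t : ℝ} (ht : 0 < t) :
    Real.sinh (2 * t) * sphDecay' lam t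
      = -1 + lam * (lam - 2) * ∫ s in Ioc 0 t, sphDecay lam s * Real.sinh (2 * s) :=
  sinh_mul_sphDecay'_eq hlam ht

include hlam in
/-- **`χ_λ′ < 0`** (row 636). -/
theorem decay_deriv_neg {t : ℝ} (ht : 0 < t) : sphDecay' lam t < 0 :=
  sphDecay'_neg hlam ht

include hlam in
/-- **`χ_λ` is strictly decreasing on `(0, ∞)`** (row 636). -/
theorem decay_strictAnti : StrictAntiOn (sphDecay lam) (Ioi 0) :=
  sphDecay_strictAntiOn hlam

include hlam in
/-- **The kernel's row is strictly increasing beyond the diagonal** (row 637). -/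
theorem kernel_row_strictMono_Ici {s : ℝ} (hs : 0 < s) : StrictMonoOn (fun t => sphGreenKernel lam t s) (Ici s) :=
  kernel_strictMonoOn_Ici hlam hs

include hlam in
/-- **For `1 < λ < 2` the kernel's row is strictly increasing on `(0, ∞)`** (row 637). -/
theorem kernel_row_strictMono_of_lt_two (h2 : lam < 2) {s : ℝ} (hs : 0 < s) :
    StrictMonoOn (fun t => sphGreenKernel lam t s) (Ioi 0) :=
  kernel_strictMonoOn_of_lt_two hlam h2 hs

include hlam in
/-- **Domination by the diagonal at the smaller variable** (row 637). -/
theorem kernel_le_diagonal_min {t s : ℝ} (ht : 0 < t) (hs : 0 < s) :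
    |sphGreenKernel lam t s| ≤ sph lam (hyp (min t s)) * sphDecay lam (min t s) :=
  abs_kernel_le_diagonal_min hlam ht hs

include hlam in
/-- **`|K_λ(t, s)| ≤ χ_λ(max(t, s))` for `1 < λ ≤ 2`** (row 638). -/
theorem kernel_le_decay_max (h2 : lam ≤ 2) {t s : ℝ} (ht : 0 < t) (hs : 0 < s) :
    |sphGreenKernel lam t s| ≤ sphDecay lam (max t s) :=
  abs_kernel_le_sphDecay_max hlam h2 ht hs

include hlam in
/-- **`χ_λ` is strictly convex on `(0, ∞)` for `λ ≥ 2`** (row 639). -/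
theorem decay_strictConvex (h2 : 2 ≤ lam) : StrictConvexOn ℝ (Ioi 0) (sphDecay lam) :=
  sphDecay_strictConvexOn hlam h2

include hlam in
/-- **The kernel's row is strictly concave beyond the diagonal for `λ ≥ 2`** (row 639). -/
theorem kernel_row_strictConcave_Ici (h2 : 2 ≤ lam) {s : ℝ} (hs : 0 < s) :
    StrictConcaveOn ℝ (Ici s) (fun t => sphGreenKernel lam t s) :=
  kernel_strictConcaveOn_Ici hlam h2 hs

end measure

end Summit.Ventures.HodgeRepro2.T5SU11RadialSummaryXXXI
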